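import Literature.NumberTheory.GaloisRepresentations.GaloisCohomologyExtOneLayerDescent
import Literature.Algebra.Homology.DiscreteRepStandardResolutionNaturality
import Literature.Algebra.Homology.DiscreteRepLayerBoundary
import Literature.NumberTheory.EllipticCurves.KummerSelmerStructure
import HarnessLib

/-!
# Naturality in the module of door-c4's descent `extOneToH1 : Ext¹_{C_Γ}(ℤ, M) → H¹(K, M)`

Theorems only (no definition, no named fact, no `sorry`, no instance, no notation).  Topic
`NumberTheory/GaloisRepresentations`; namespace `Literature.NumberTheory.GaloisRepresentations.ExtOneDescent`.

The Poitou–Tate presentation road (door-c4/c5/c6 + chl-p2, `PoitouTateShaTwoReadout.*`) reads a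
class `y ∈ H¹(K, ·)` in `Ext¹_{C_Γ}(ℤ, ·)` through a bridge `nat`; the canonical bridge is door-c4's
descent `ExtOneDescent.extOneToH1 K ρ` (`GaloisCohomologyExtOneLayerDescent.lean`: the colimit
`Ext¹_{C_Γ}(ℤ, M) = lim→_U H¹(Γ_K ⧸ U, M^U)` made explicit, `LayerColimit.desc` of the layer inflations).
For the pairing built on that road to be NATURAL IN THE MODULE (what the natural restricted Poitou–Tate
fact `poitouTate_shaRestricted_tateDual_natural` asks of a kernel discharge; cell `bsd-eis`, lane
«PT-Ш-S-TC», scoping memo `D5-NATURALITY-SCOPING-w2g11.md` item (N-P3)) the bridge must commute with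
the maps induced by a morphism of modules.  This file proves it:

* `ExtOneDescent.layerInfOne_map` — the layer inflation `H¹(Γ_K ⧸ U_E, M^{U_E}) → H¹(K, M)` commutes
  with a continuous `Γ_K`-map `f : M → M'` (cocycle formula `σ ↦ γ(σ̄)` on both sides);
* **`ExtOneDescent.extOneToH1_map`** — `extOneToH1 K ρ' (x ≫ f) = H¹(K, f) (extOneToH1 K ρ x)`: `x` is
  inflated from a layer (`LayerColimit.exists_inflG_eq`), where this is door-c4's `LayerColimit.inflG_map`
  (`DiscreteRepLayerBoundary.lean`, naturality of `inflG` in the module) + `layerInfOne_map`; and the same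
  for the inverse equivalence `extOneEquivH1` of a finite module (`extOneEquivH1_symm_map`), the form in
  which a bridge `nat := extOneEquivH1⁻¹` is consumed.

No arithmetic; nothing about Poitou–Tate duality or BSD is proved here.
AI formalisation, weaker than expert review; the statements are established only by the kernel check.

## References
* J.-P. Serre, *Galois Cohomology* (1997), I §2.2 Proposition 8 (`Hⁿ(Γ, M) = lim→ Hⁿ(Γ/U, M^U)`,
  functorial in `M`). [SerreGaloisCohomology1997]
* D. Harari, *Galois Cohomology and Class Field Theory* (2020), §4.3 Remark 4.24. [Harari2020]
-/

noncomputable section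

open CategoryTheory CategoryTheory.Abelian groupCohomology Field Function
open Literature.Algebra.Homology Literature.Algebra.Homology.DiscreteRep
open scoped ContRepresentation

/-! ## `layerInfOne` and `extOneToH1` are natural in the module -/

namespace Literature.NumberTheory.GaloisRepresentations

namespace ExtOneDescent

open LayerDelta IdeleClassBar LayerColimit

variable (K : Type) [Field K]
variable {M : Type} [AddCommGroup M] [TopologicalSpace M] [DiscreteTopology M] (ρ : DiscreteGaloisModule K M)
variable {M' : Type} [AddCommGroup M'] [TopologicalSpace M'] [DiscreteTopology M']
  (ρ' : DiscreteGaloisModule K M')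

/-- **The layer inflation in degree one commutes with a morphism of modules**:
`layerInfOne E (H¹(Γ_K⧸U_E, f^{U_E}) c) = H¹(K, f) (layerInfOne E c)` — both are `[σ ↦ f (γ(σ̄))]`.
[cite: SerreGaloisCohomology1997, I §2.2 Proposition 8] -/
theorem layerInfOne_map [CompactSpace (absoluteGaloisGroup K)]
    (f : ρ.toContRepresentation →ⁱL ρ'.toContRepresentation) (E : GalLayer K)
    (c : groupCohomology ((invariantsQuotFunctor ℤ (E.openNormalSubgroup : Subgroup (absoluteGaloisGroup K))).obj
      (ofDiscreteGaloisModule ρ)) 1) :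
    layerInfOne K ρ' E ((groupCohomology.map (MonoidHom.id _)
        ((invariantsQuotFunctor ℤ (E.openNormalSubgroup : Subgroup (absoluteGaloisGroup K))).map
          (ofDiscreteGaloisModuleMap ρ ρ' f)) 1).hom c) =
      galoisCohomology.map f 1 (layerInfOne K ρ E c) := by
  induction c using H1_induction_on with
  | h γ =>
    change layerInfOne K ρ' E (groupCohomology.map _ _ 1 (H1π _ γ)) = _
    rw [H1π_comp_map_apply, layerInfOne_H1π, layerInfOne_H1π, galoisCohomology.map_one_oneCocycleClass]
    exact congrArg (oneCocycleClass _) (Subtype.ext (ContinuousMap.ext fun σ => rfl))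

variable [NumberField K]

/-- **Naturality of door-c4's descent `extOneToH1 : Ext¹_{C_Γ}(ℤ, M) → H¹(K, M)` in the module**:
`extOneToH1 K ρ' (x ≫ f) = H¹(K, f) (extOneToH1 K ρ x)` for a continuous `Γ_K`-map `f : M → M'`
(`x ≫ f` = post-composition with `Ext.mk₀ (ofDiscreteGaloisModuleMap ρ ρ' f)`).  Proof: `x` is inflated
from a layer (`LayerColimit.exists_inflG_eq`), where it is `LayerColimit.inflG_map` + `layerInfOne_map`.
[cite: SerreGaloisCohomology1997, I §2.2 Proposition 8] [cite: Harari2020, §4.3 Remark 4.24] -/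
theorem extOneToH1_map [CompactSpace (absoluteGaloisGroup K)]
    (f : ρ.toContRepresentation →ⁱL ρ'.toContRepresentation)
    (x : Abelian.Ext (triv (Γ := absoluteGaloisGroup K) ℤ) (ofDiscreteGaloisModule ρ) 1) :
    extOneToH1 K ρ' (x.comp (Ext.mk₀ (ofDiscreteGaloisModuleMap ρ ρ' f)) (add_zero 1)) =
      galoisCohomology.map f 1 (extOneToH1 K ρ x) := by
  haveI : TotallyDisconnectedSpace (absoluteGaloisGroup K) := inferInstance
  obtain ⟨W, c, rfl⟩ := LayerColimit.exists_inflG_eq 1 (ofDiscreteGaloisModule ρ) x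
  obtain ⟨E, hE⟩ : ∃ E : GalLayer K, E.openNormalSubgroup = W :=
    ⟨GalLayer.ofOpenNormalSubgroup W, GalLayer.openNormalSubgroup_ofOpenNormalSubgroup W⟩
  subst hE
  rw [← LayerColimit.inflG_map, extOneToH1_inflG, extOneToH1_inflG, layerInfOne_map]

/-- The same in the `TopRep`-morphism currency (`cohomologyMap F 1 = galoisCohomology.map F.hom 1`).
[cite: SerreGaloisCohomology1997, I §2.2 Proposition 8] -/
theorem extOneToH1_map' [CompactSpace (absoluteGaloisGroup K)] (F : ρ.toTopRep ⟶ ρ'.toTopRep)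
    (x : Abelian.Ext (triv (Γ := absoluteGaloisGroup K) ℤ) (ofDiscreteGaloisModule ρ) 1) :
    extOneToH1 K ρ' (x.comp (Ext.mk₀ (ofDiscreteGaloisModuleMap ρ ρ' F.hom)) (add_zero 1)) =
      cohomologyMap F 1 (extOneToH1 K ρ x) :=
  extOneToH1_map K ρ ρ' F.hom x

/-- **Naturality of the inverse bijection** `extOneEquivH1⁻¹ : H¹(K, M) ≃ Ext¹_{C_Γ}(ℤ, M)` (finite modules):
`(extOneEquivH1 ρ')⁻¹ (H¹(K, f) y) = (extOneEquivH1 ρ)⁻¹ y ≫ f` — the form in which a bridge `nat := extOneEquivH1⁻¹`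
of the Poitou–Tate presentation road is consumed. [cite: SerreGaloisCohomology1997, I §2.2 Proposition 8] -/
theorem extOneEquivH1_symm_map [CompactSpace (absoluteGaloisGroup K)] [Finite M] [Finite M']
    (f : ρ.toContRepresentation →ⁱL ρ'.toContRepresentation) (y : galoisCohomology ρ 1) :
    (extOneEquivH1 K ρ').symm (galoisCohomology.map f 1 y) =
      ((extOneEquivH1 K ρ).symm y).comp (Ext.mk₀ (ofDiscreteGaloisModuleMap ρ ρ' f)) (add_zero 1) := by
  apply (extOneEquivH1 K ρ').injective
  rw [AddEquiv.apply_symm_apply, extOneEquivH1_apply, extOneToH1_map, ← extOneEquivH1_apply,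
    AddEquiv.apply_symm_apply]

end ExtOneDescent

end Literature.NumberTheory.GaloisRepresentations

end
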